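import Literature.NumberTheory.Weil1964.ArchMetaplecticDoubleCover
import Literature.NumberTheory.Weil1964.ArchWeilDatumTensor
import HarnessLib

/-!
# The twisted diagonal `Sp(W) → Sp(W ⊕ W)`, `T ↦ T ⊕ c T c`, lies in a conjugate of the Siegel Levi (doubling geometry)

Topic `NumberTheory/Weil1964`; namespace `Literature.NumberTheory.Weil1964.Sp`.  Symplectic linear algebra on weil-1's
`Sp(W)`, `W = ℝ^σ × ℝ^σ` with the form `ω(w, w') = p · q' − p' · q` (`symplecticGroup (polar (dotPairing σ))`), its
block sum `spBlock : Sp(W₁) × Sp(W₂) →* Sp(W₁ ⊕ W₂)` (`ArchWeilDatumTensor`) and its Siegel Levi elements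
`m(a, d) = leviSp a d`, `a x · d y = x · y` (`ArchMetaplecticDoubleCover`).  KERNEL only: no record, no `sorry`.

* §1 `det T = 1` for every `T ∈ Sp(W)` (`Sp.det_eq_one` — Mathlib's `SymplecticGroup.det_eq_one` transported along
  the tree's `SpTransport.transportSp`).
* §2 the anti-symplectic involution `c(p, q) = (p, −q)` (complex conjugation under `(p, q) ↔ p + iq`):
  `ω(c w, c w') = −ω(w, w')`, and the involutive automorphism `conjSp : Sp(W) →* Sp(W)`, `T ↦ c T c`.
* §3 the DOUBLED space `W ⊕ W` (index type `σ ⊕ σ`, form `ω ⊕ ω`) and its two transverse Lagrangians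
  `Δ_c = {(w, c w)}`, `Δ_c⁻ = {(w, −c w)}` (the graph of `c` is Lagrangian because `c` is anti-symplectic — under
  `c : (W, ω) ≅ (W, −ω)` this is the diagonal of `W ⊕ W⁻` of the doubling method): the frames
  `dblD : ℝ^{σ ⊕ σ} ≃ W` (`x ↦ (x|₁, ½ x|₂)`), `dblE : ℝ^{σ ⊕ σ} ≃ W` (`y ↦ (−y|₂, ½ y|₁)`) with
  `x · y = 2 ω(dblD x, dblE y)` (`dot_eq_two_omega`), and the BEAM SPLITTER `beamSplitter ∈ Sp(W ⊕ W)`,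
  `(P, Q) ↦ (dblD P + dblE Q, c (dblD P − dblE Q))`, carrying the standard polarisation `ℝ^{σ⊕σ} × 0`, `0 × ℝ^{σ⊕σ}`
  of `W ⊕ W` onto `(Δ_c, Δ_c⁻)`;
* §4 for `T ∈ Sp(W)` the Levi data `leviA T = dblD⁻¹ T dblD`, `leviD T = dblE⁻¹ T dblE` (`leviA_had`: `ᵗ(leviA T)⁻¹ =
  leviD T` because `T` is symplectic; `leviA`, `leviD` multiplicative; `det (leviA T) = det T = 1 > 0`) and
  **THE CONJUGATION IDENTITY** `spBlock (T, c T c) * beamSplitter = beamSplitter * m(leviA T, leviD T)`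
  (`spBlock_conjSp_mul_beamSplitter`): the twisted diagonal `{T ⊕ cTc}` — equivalently the diagonal `Sp(W)` of
  `Sp(W ⊕ W⁻)` — is contained in the stabiliser of the Lagrangian pair `(Δ_c, Δ_c⁻)`, a conjugate of the POSITIVE
  Siegel Levi `GL⁺(ℝ^{σ⊕σ})`.

This is the linear algebra behind "the diagonal `G × G ↪ Sp(W ⊕ W⁻)` stabilises the Lagrangian `W^Δ`" of the doubling
method [GelbartPiatetskishapiroRallis1987, §1; Li1992, p. 181 (the element `δ` carrying `W^Δ` to `𝕐`); cf. the tree's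
`DoublingDiagonalPolarisation` for the rational matrix form] and behind the pub-hodgecm2 literature fan-out row B08-2 (b)
[Paul1998, (1.2.1)]: for the dual pair `(U(V), U(W'))` and a hyperbolic plane `H = ⟨e₊, e₋⟩ ⊂ W'`, the embedding
`ι_V(g)` on `V ⊗ H ≅ V ⊕ V` is `T_g ⊕ c T_g c` in the tree's block coordinates, so with the sequel
(`ArchMetaplecticLeviCover`: the metaplectic cover splits over the positive Siegel Levi by the geometric section) the
metaplectic 2-cocycle of `U(V)` is trivial on every hyperbolic plane of `W'`.

## References

* [GelbartPiatetskishapiroRallis1987] S. Gelbart, I. Piatetski-Shapiro, S. Rallis, *Explicit constructions of automorphic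
  L-functions*, LNM 1254 (1987), Part A (Piatetski-Shapiro–Rallis, *L-functions for the classical groups*) §1 (the
  diagonal embedding `G × G ↪ Sp(W ⊕ W⁻)` and the Siegel parabolic stabilising `W^Δ`).
* [Li1992] J.-S. Li, *Non-vanishing theorems for the cohomology of certain arithmetic quotients*, J. reine angew. Math.
  428 (1992), p. 181.
* [Folland1989] G. B. Folland, *Harmonic Analysis in Phase Space*, Princeton UP 1989, §4.1 Prop. (4.1)–(4.4), (4.6);
  §4.2 (4.24).
* [Paul1998] A. Paul, *Howe correspondence for real unitary groups*, J. Funct. Anal. 159 (1998), §1.2 (1.2.1).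
-/

set_option autoImplicit false

noncomputable section

open Matrix

namespace Literature.NumberTheory.Weil1964

open Literature.Analysis.SegalBargmann Literature.RepresentationTheory.HeisenbergGroup

variable {σ : Type*} [Fintype σ] [DecidableEq σ]

local notation "PV" σ => (σ → ℝ) × (σ → ℝ)
local notation "SpR" σ => symplecticGroup (polar (dotPairing σ))

namespace Sp

/-! ## 1. `det T = 1` on `Sp(W)` -/

/-- Auxiliary form over the matrix pairing of `1` (so that `SpTransport` applies literally). [folklore] -/
private theorem det_eq_one_aux (β : (σ → ℝ) →ₗ[ℝ] (σ → ℝ) →ₗ[ℝ] ℝ) (hβ : β = Matrix.toLinearMap₂' ℝ (1 : Matrix σ σ ℝ))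
    (T : symplecticGroup (polar β)) : LinearMap.det ((T : (PV σ) ≃ₗ[ℝ] PV σ) : (PV σ) →ₗ[ℝ] PV σ) = 1 := by
  subst hβ
  have h1 : IsUnit (1 : Matrix σ σ ℝ).det := by rw [Matrix.det_one]; exact isUnit_one
  obtain ⟨A, hA⟩ : T ∈ (SymplecticMatrix.transportSp (1 : Matrix σ σ ℝ) h1).range := by
    rw [Literature.NumberTheory.Automorphic.UnitaryGroup.SpTransport.range_transportSp_eq_top]; trivial
  rw [← hA]
  have e : ((SymplecticMatrix.transportSp (1 : Matrix σ σ ℝ) h1 A : symplecticGroup _) : (PV σ) ≃ₗ[ℝ] PV σ).toLinearMap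
      = ((SymplecticMatrix.darboux (1 : Matrix σ σ ℝ) h1).symm : (σ ⊕ σ → ℝ) →ₗ[ℝ] PV σ) ∘ₗ
          Matrix.toLin' (A : Matrix (σ ⊕ σ) (σ ⊕ σ) ℝ) ∘ₗ
          ((SymplecticMatrix.darboux (1 : Matrix σ σ ℝ) h1).symm.symm : (PV σ) →ₗ[ℝ] (σ ⊕ σ → ℝ)) :=
    LinearMap.ext fun v => by
      rw [LinearEquiv.coe_toLinearMap, SymplecticMatrix.coe_transportSp_apply, LinearEquiv.symm_symm]
      rfl
  rw [e, LinearMap.det_conj, LinearMap.det_toLin']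
  exact SymplecticGroup.det_eq_one A.2

/-- **`det T = 1` for `T ∈ Sp(W)`** (Mathlib's `SymplecticGroup.det_eq_one`, transported from matrices to weil-1's
`Sp(W)`). [cite: Folland1989, §4.1 Prop. (4.4)] -/
theorem det_eq_one (T : SpR σ) : LinearMap.det ((T : (PV σ) ≃ₗ[ℝ] PV σ) : (PV σ) →ₗ[ℝ] PV σ) = 1 :=
  det_eq_one_aux _ (toLinearMap₂'_one_eq_dotPairing σ).symm T

/-! ## 2. The anti-symplectic involution `c (p, q) = (p, −q)` and `T ↦ c T c` -/

variable (σ) in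
/-- **Complex conjugation of `W = ℂ^σ`** in real coordinates: `c (p, q) = (p, −q)`. [cite: Folland1989, §4.1 Prop. (4.6)] -/
def conjW : (PV σ) ≃ₗ[ℝ] PV σ := LinearEquiv.prodCongr (LinearEquiv.refl ℝ (σ → ℝ)) (LinearEquiv.neg ℝ)

omit [Fintype σ] [DecidableEq σ] in
/-- `c (p, q) = (p, −q)`. [cite: Folland1989, §4.1 Prop. (4.6)] -/
@[simp] theorem conjW_apply (v : PV σ) : conjW σ v = (v.1, -v.2) := rfl

omit [Fintype σ] [DecidableEq σ] in
/-- `c` is an involution. [cite: Folland1989, §4.1 Prop. (4.6)] -/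
@[simp] theorem conjW_conjW (v : PV σ) : conjW σ (conjW σ v) = v := by
  rw [conjW_apply, conjW_apply, neg_neg]

omit [Fintype σ] [DecidableEq σ] in
/-- `c⁻¹ = c`. [cite: Folland1989, §4.1 Prop. (4.6)] -/
@[simp] theorem conjW_symm : (conjW σ).symm = conjW σ :=
  LinearEquiv.ext fun v => (conjW σ).injective (by rw [LinearEquiv.apply_symm_apply, conjW_conjW])

omit [DecidableEq σ] in
/-- **`c` is anti-symplectic**: `p · (−q') = −(p · q')`, so `ω(c w, c w') = −ω(w, w')`. [cite: Folland1989, §4.1 Prop. (4.1)] -/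
theorem polar_conjW (v w : PV σ) : polar (dotPairing σ) (conjW σ v) (conjW σ w) = -polar (dotPairing σ) v w := by
  rw [polar_apply, polar_apply, dotPairing_apply, dotPairing_apply, conjW_apply, conjW_apply]
  exact dotProduct_neg _ _

omit [DecidableEq σ] in
/-- `c T c` is symplectic for symplectic `T`. [cite: Folland1989, §4.1 Prop. (4.1)] -/
theorem conj_mem (T : SpR σ) : (conjW σ).trans (((T : SpR σ) : (PV σ) ≃ₗ[ℝ] PV σ).trans (conjW σ)) ∈ SpR σ := by
  rw [mem_symplecticGroup]
  intro w w'
  have h := (mem_symplecticGroup _ _).1 T.2 (conjW σ w) (conjW σ w')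
  rw [polar_conjW, polar_conjW] at h
  rw [LinearEquiv.trans_apply, LinearEquiv.trans_apply, LinearEquiv.trans_apply, LinearEquiv.trans_apply, polar_conjW,
    polar_conjW]
  linear_combination -h

variable (σ) in
/-- **`conjSp : Sp(W) →* Sp(W)`, `T ↦ c T c`** (Folland: `𝒜 ↦ 𝒜̄` under `W ≅ ℂ^σ`). [cite: Folland1989, §4.1 Prop. (4.1), (4.17)] -/
def conjSp : (SpR σ) →* SpR σ where
  toFun T := ⟨(conjW σ).trans (((T : SpR σ) : (PV σ) ≃ₗ[ℝ] PV σ).trans (conjW σ)), conj_mem T⟩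
  map_one' := Subtype.ext (LinearEquiv.ext fun v => by
    show conjW σ (((1 : SpR σ) : (PV σ) ≃ₗ[ℝ] PV σ) (conjW σ v)) = v
    rw [OneMemClass.coe_one, LinearEquiv.coe_one, id_eq, conjW_conjW])
  map_mul' T T' := Subtype.ext (LinearEquiv.ext fun v => by
    show conjW σ (((T * T' : SpR σ) : (PV σ) ≃ₗ[ℝ] PV σ) (conjW σ v)) =
      conjW σ ((T : (PV σ) ≃ₗ[ℝ] PV σ) (conjW σ (conjW σ ((T' : (PV σ) ≃ₗ[ℝ] PV σ) (conjW σ v)))))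
    rw [conjW_conjW, Subgroup.coe_mul, LinearEquiv.mul_apply])

omit [DecidableEq σ] in
/-- `(c T c) v = c (T (c v))`. [cite: Folland1989, §4.1 (4.17)] -/
@[simp] theorem coe_conjSp_apply (T : SpR σ) (v : PV σ) :
    ((conjSp σ T : SpR σ) : (PV σ) ≃ₗ[ℝ] PV σ) v = conjW σ ((T : (PV σ) ≃ₗ[ℝ] PV σ) (conjW σ v)) := rfl

omit [DecidableEq σ] in
/-- `conjSp` is an involution. [cite: Folland1989, §4.1 (4.17)] -/
@[simp] theorem conjSp_conjSp (T : SpR σ) : conjSp σ (conjSp σ T) = T :=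
  Subtype.ext (LinearEquiv.ext fun v => by rw [coe_conjSp_apply, coe_conjSp_apply, conjW_conjW, conjW_conjW])

/-! ## 3. The doubled space `W ⊕ W`, the Lagrangian frames `dblD`, `dblE`, and the beam splitter -/

variable (σ) in
/-- The frame of `Δ_c`: `x ↦ (x|₁, ½ x|₂) ∈ W`. [cite: Li1992, p. 181] -/
def dblD : (σ ⊕ σ → ℝ) ≃ₗ[ℝ] PV σ where
  toFun x := (x ∘ Sum.inl, (2 : ℝ)⁻¹ • (x ∘ Sum.inr))
  invFun w := Sum.elim w.1 ((2 : ℝ) • w.2)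
  map_add' x y := by ext i <;> simp [mul_add]
  map_smul' r x := by ext i <;> simp [mul_left_comm]
  left_inv x := by
    ext i; rcases i with i | i <;> simp
  right_inv w := by
    ext i <;> simp

variable (σ) in
/-- The frame of `Δ_c⁻`: `y ↦ (−y|₂, ½ y|₁) ∈ W`. [cite: Li1992, p. 181] -/
def dblE : (σ ⊕ σ → ℝ) ≃ₗ[ℝ] PV σ where
  toFun y := (-(y ∘ Sum.inr), (2 : ℝ)⁻¹ • (y ∘ Sum.inl))
  invFun w := Sum.elim ((2 : ℝ) • w.2) (-w.1)
  map_add' x y := by ext i <;> simp [mul_add]; ring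
  map_smul' r x := by ext i <;> simp [mul_left_comm]
  left_inv y := by
    ext i; rcases i with i | i <;> simp
  right_inv w := by
    ext i <;> simp

omit [Fintype σ] [DecidableEq σ] in
/-- Unfolding of `dblD` (the frame of the diagonal Lagrangian). [cite: Li1992, p. 181] -/
@[simp] theorem dblD_apply (x : σ ⊕ σ → ℝ) : dblD σ x = (x ∘ Sum.inl, (2 : ℝ)⁻¹ • (x ∘ Sum.inr)) := rfl

omit [Fintype σ] [DecidableEq σ] in
/-- Unfolding of `dblE` (the frame of the anti-diagonal Lagrangian). [cite: Li1992, p. 181] -/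
@[simp] theorem dblE_apply (y : σ ⊕ σ → ℝ) : dblE σ y = (-(y ∘ Sum.inr), (2 : ℝ)⁻¹ • (y ∘ Sum.inl)) := rfl

omit [DecidableEq σ] in
/-- **`x · y = 2 ω(dblD x, dblE y)`**: the pairing of the standard polarisation of `W ⊕ W` read in the frames of
`Δ_c`, `Δ_c⁻`. [cite: Li1992, p. 181] -/
theorem dot_eq_two_omega (x y : σ ⊕ σ → ℝ) :
    x ⬝ᵥ y = 2 * (polar (dotPairing σ) (dblD σ x) (dblE σ y) - polar (dotPairing σ) (dblE σ y) (dblD σ x)) := by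
  rw [polar_apply, polar_apply, dotPairing_apply, dotPairing_apply, dblD_apply, dblE_apply, dotProduct_eq_inl_add_inr]
  simp only [dotProduct_smul, neg_dotProduct, smul_eq_mul]
  rw [dotProduct_comm (y ∘ Sum.inr) (x ∘ Sum.inr)]
  ring

variable (σ) in
/-- `(w, w') ↦ (w + w', w − w')` on `W × W` (inverse `(u, v) ↦ (½(u + v), ½(u − v))`). [cite: Li1992, p. 181] -/
def sumDiff : ((PV σ) × PV σ) ≃ₗ[ℝ] ((PV σ) × PV σ) where
  toFun w := (w.1 + w.2, w.1 - w.2)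
  invFun u := ((2 : ℝ)⁻¹ • (u.1 + u.2), (2 : ℝ)⁻¹ • (u.1 - u.2))
  map_add' w w' := by ext <;> simp <;> ring
  map_smul' r w := by ext <;> simp <;> ring
  left_inv w := by ext <;> simp <;> ring
  right_inv u := by ext <;> simp <;> ring

omit [Fintype σ] [DecidableEq σ] in
/-- Unfolding of `sumDiff`. [cite: Li1992, p. 181] -/
@[simp] theorem sumDiff_apply (w : (PV σ) × PV σ) : sumDiff σ w = (w.1 + w.2, w.1 - w.2) := rfl

variable (σ) in
/-- **The beam splitter** as a linear automorphism of `W ⊕ W`: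
`(P, Q) ↦ (dblD P + dblE Q, c (dblD P − dblE Q))` in the two copies — it carries `ℝ^{σ⊕σ} × 0` onto
`Δ_c = {(w, c w)}` and `0 × ℝ^{σ⊕σ}` onto `Δ_c⁻ = {(w, −c w)}`. [cite: GelbartPiatetskishapiroRallis1987, §1] -/
def beamLin : (PV (σ ⊕ σ)) ≃ₗ[ℝ] PV (σ ⊕ σ) :=
  ((dblD σ).prodCongr (dblE σ)).trans ((sumDiff σ).trans
    (((LinearEquiv.refl ℝ (PV σ)).prodCongr (conjW σ)).trans
      (Literature.NumberTheory.Automorphic.UnitaryGroup.sumSplit ℝ σ σ).symm))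

omit [Fintype σ] [DecidableEq σ] in
/-- The beam splitter on `(P, Q)`, in the two copies of `W`. [cite: GelbartPiatetskishapiroRallis1987, §1] -/
theorem beamLin_apply (PQ : PV (σ ⊕ σ)) :
    beamLin σ PQ = (Literature.NumberTheory.Automorphic.UnitaryGroup.sumSplit ℝ σ σ).symm
      (dblD σ PQ.1 + dblE σ PQ.2, conjW σ (dblD σ PQ.1 - dblE σ PQ.2)) := rfl

omit [DecidableEq σ] in
/-- The form of `W ⊕ W` is the sum of the forms of the two copies. [cite: Weil1964, Chap. I n° 12, p. 160] -/
theorem polar_sumSplit_symm (u v : (PV σ) × PV σ) :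
    polar (dotPairing (σ ⊕ σ)) ((Literature.NumberTheory.Automorphic.UnitaryGroup.sumSplit ℝ σ σ).symm u)
        ((Literature.NumberTheory.Automorphic.UnitaryGroup.sumSplit ℝ σ σ).symm v) =
      polar (dotPairing σ) u.1 v.1 + polar (dotPairing σ) u.2 v.2 := by
  simp only [polar_apply, dotPairing_apply, Literature.NumberTheory.Automorphic.UnitaryGroup.sumSplit_symm_apply,
    sumElim_dotProduct_sumElim]

omit [DecidableEq σ] in
/-- **The beam splitter is symplectic.** [cite: GelbartPiatetskishapiroRallis1987, §1] -/
theorem beamLin_mem : beamLin σ ∈ SpR (σ ⊕ σ) := by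
  rw [mem_symplecticGroup]
  rintro ⟨P, Q⟩ ⟨P', Q'⟩
  rw [beamLin_apply, beamLin_apply, polar_sumSplit_symm, polar_sumSplit_symm]
  simp only [map_add, map_sub, LinearMap.add_apply, LinearMap.sub_apply, polar_conjW]
  have h1 : polar (dotPairing (σ ⊕ σ)) (P, Q) (P', Q') = P ⬝ᵥ Q' := rfl
  have h2 : polar (dotPairing (σ ⊕ σ)) (P', Q') (P, Q) = P' ⬝ᵥ Q := rfl
  rw [h1, h2, dot_eq_two_omega, dot_eq_two_omega]
  ring

variable (σ) in
/-- **The beam splitter `∈ Sp(W ⊕ W)`.** [cite: GelbartPiatetskishapiroRallis1987, §1] -/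
def beamSplitter : SpR (σ ⊕ σ) := ⟨beamLin σ, beamLin_mem⟩

omit [DecidableEq σ] in
/-- Unfolding of `beamSplitter`. [cite: GelbartPiatetskishapiroRallis1987, §1] -/
@[simp] theorem coe_beamSplitter : ((beamSplitter σ : SpR (σ ⊕ σ)) : (PV (σ ⊕ σ)) ≃ₗ[ℝ] PV (σ ⊕ σ)) = beamLin σ := rfl

/-! ## 4. The Levi data of `T ∈ Sp(W)` and the conjugation identity -/

/-- `leviA T = dblD⁻¹ ∘ T ∘ dblD` — the action of `T ⊕ cTc` on `Δ_c` read in the frame `dblD`. [cite: GelbartPiatetskishapiroRallis1987, §1] -/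
def leviA (T : SpR σ) : (σ ⊕ σ → ℝ) ≃ₗ[ℝ] (σ ⊕ σ → ℝ) :=
  (dblD σ).trans (((T : SpR σ) : (PV σ) ≃ₗ[ℝ] PV σ).trans (dblD σ).symm)

/-- `leviD T = dblE⁻¹ ∘ T ∘ dblE` — the action of `T ⊕ cTc` on `Δ_c⁻` read in the frame `dblE`. [cite: GelbartPiatetskishapiroRallis1987, §1] -/
def leviD (T : SpR σ) : (σ ⊕ σ → ℝ) ≃ₗ[ℝ] (σ ⊕ σ → ℝ) :=
  (dblE σ).trans (((T : SpR σ) : (PV σ) ≃ₗ[ℝ] PV σ).trans (dblE σ).symm)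

omit [DecidableEq σ] in
/-- `dblD (leviA T x) = T (dblD x)`. [cite: Li1992, p. 181] -/
@[simp] theorem dblD_leviA (T : SpR σ) (x : σ ⊕ σ → ℝ) :
    dblD σ (leviA T x) = (T : (PV σ) ≃ₗ[ℝ] PV σ) (dblD σ x) := by
  rw [leviA, LinearEquiv.trans_apply, LinearEquiv.trans_apply, LinearEquiv.apply_symm_apply]

omit [DecidableEq σ] in
/-- `dblE (leviD T y) = T (dblE y)`. [cite: Li1992, p. 181] -/
@[simp] theorem dblE_leviD (T : SpR σ) (y : σ ⊕ σ → ℝ) :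
    dblE σ (leviD T y) = (T : (PV σ) ≃ₗ[ℝ] PV σ) (dblE σ y) := by
  rw [leviD, LinearEquiv.trans_apply, LinearEquiv.trans_apply, LinearEquiv.apply_symm_apply]

omit [DecidableEq σ] in
/-- **`leviA T x · leviD T y = x · y`** (`ᵗ(leviA T)⁻¹ = leviD T`): because `T` is symplectic and `x · y =
2ω(dblD x, dblE y)`. [cite: Folland1989, §4.1 (4.4); GelbartPiatetskishapiroRallis1987, §1] -/
theorem leviA_had (T : SpR σ) (x y : σ ⊕ σ → ℝ) :
    dotPairing (σ ⊕ σ) (leviA T x) (leviD T y) = dotPairing (σ ⊕ σ) x y := by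
  rw [dotPairing_apply, dotPairing_apply, dot_eq_two_omega, dot_eq_two_omega, dblD_leviA, dblE_leviD]
  have h := (mem_symplecticGroup _ _).1 T.2 (dblD σ x) (dblE σ y)
  rw [h]

omit [DecidableEq σ] in
/-- `leviA` is multiplicative. [cite: Folland1989, §4.1 (4.4); Li1992, p. 181] -/
theorem leviA_mul (T T' : SpR σ) : leviA (T * T') = leviA T * leviA T' :=
  LinearEquiv.ext fun x => (dblD σ).injective (by
    rw [dblD_leviA, LinearEquiv.mul_apply, dblD_leviA, dblD_leviA, Subgroup.coe_mul, LinearEquiv.mul_apply])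

omit [DecidableEq σ] in
/-- `leviD` is multiplicative. [cite: Folland1989, §4.1 (4.4); Li1992, p. 181] -/
theorem leviD_mul (T T' : SpR σ) : leviD (T * T') = leviD T * leviD T' :=
  LinearEquiv.ext fun y => (dblE σ).injective (by
    rw [dblE_leviD, LinearEquiv.mul_apply, dblE_leviD, dblE_leviD, Subgroup.coe_mul, LinearEquiv.mul_apply])

omit [DecidableEq σ] in
/-- `leviA 1 = 1`. [cite: Folland1989, §4.1 (4.4)] -/
@[simp] theorem leviA_one : leviA (1 : SpR σ) = 1 :=
  LinearEquiv.ext fun x => (dblD σ).injective (by rw [dblD_leviA]; rfl)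

omit [DecidableEq σ] in
/-- `leviD 1 = 1`. [cite: Folland1989, §4.1 (4.4)] -/
@[simp] theorem leviD_one : leviD (1 : SpR σ) = 1 :=
  LinearEquiv.ext fun y => (dblE σ).injective (by rw [dblE_leviD]; rfl)

/-- **`det (leviA T) = 1`** (`= det T`); in particular `leviA T` lies in the POSITIVE Levi `GL⁺`.
[cite: Folland1989, §4.1 Prop. (4.4)] -/
theorem det_leviA (T : SpR σ) : LinearMap.det ((leviA T : (σ ⊕ σ → ℝ) ≃ₗ[ℝ] (σ ⊕ σ → ℝ)) :
    (σ ⊕ σ → ℝ) →ₗ[ℝ] (σ ⊕ σ → ℝ)) = 1 := by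
  have e : ((leviA T : (σ ⊕ σ → ℝ) ≃ₗ[ℝ] (σ ⊕ σ → ℝ)) : (σ ⊕ σ → ℝ) →ₗ[ℝ] (σ ⊕ σ → ℝ)) =
      ((dblD σ).symm : (PV σ) →ₗ[ℝ] (σ ⊕ σ → ℝ)) ∘ₗ ((T : (PV σ) ≃ₗ[ℝ] PV σ) : (PV σ) →ₗ[ℝ] PV σ) ∘ₗ
        (((dblD σ).symm.symm : (σ ⊕ σ → ℝ) ≃ₗ[ℝ] PV σ) : (σ ⊕ σ → ℝ) →ₗ[ℝ] PV σ) :=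
    LinearMap.ext fun x => rfl
  rw [e, LinearMap.det_conj, det_eq_one]

/-- `0 < det (leviA T)`. [cite: Folland1989, §4.1 Prop. (4.4)] -/
theorem det_leviA_pos (T : SpR σ) : 0 < LinearMap.det ((leviA T : (σ ⊕ σ → ℝ) ≃ₗ[ℝ] (σ ⊕ σ → ℝ)) :
    (σ ⊕ σ → ℝ) →ₗ[ℝ] (σ ⊕ σ → ℝ)) := by
  rw [det_leviA]; exact one_pos

omit [DecidableEq σ] in
/-- `spBlock (g₁, g₂)` acts copy by copy: `(g₁ ⊕ g₂)(u ⊔ v) = g₁ u ⊔ g₂ v`. [cite: Weil1964, Chap. I n° 12, p. 160] -/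
theorem spBlock_sumSplit_symm (g₁ g₂ : SpR σ) (u v : PV σ) :
    ((spBlock (g₁, g₂) : SpR (σ ⊕ σ)) : (PV (σ ⊕ σ)) ≃ₗ[ℝ] PV (σ ⊕ σ))
        ((Literature.NumberTheory.Automorphic.UnitaryGroup.sumSplit ℝ σ σ).symm (u, v)) =
      (Literature.NumberTheory.Automorphic.UnitaryGroup.sumSplit ℝ σ σ).symm
        ((g₁ : (PV σ) ≃ₗ[ℝ] PV σ) u, (g₂ : (PV σ) ≃ₗ[ℝ] PV σ) v) := by
  rw [coe_spBlock, Literature.NumberTheory.Automorphic.UnitaryGroup.spSumEquiv_apply]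
  simp only [Literature.NumberTheory.Automorphic.UnitaryGroup.sumSplit_symm_apply, Sum.elim_comp_inl,
    Sum.elim_comp_inr, Prod.mk.eta]

omit [DecidableEq σ] in
/-- **THE CONJUGATION IDENTITY**: `(T ⊕ cTc) ∘ beamSplitter = beamSplitter ∘ m(leviA T, leviD T)` — the twisted
diagonal lies in the stabiliser of `(Δ_c, Δ_c⁻)`, the `beamSplitter`-conjugate of the Siegel Levi, with Levi component
`leviA T` of determinant one. [cite: GelbartPiatetskishapiroRallis1987, §1; Li1992, p. 181] -/
theorem spBlock_conjSp_mul_beamSplitter (T : SpR σ) :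
    spBlock (T, conjSp σ T) * beamSplitter σ =
      beamSplitter σ * leviSp (dotPairing (σ ⊕ σ)) (leviA T) (leviD T) (leviA_had T) := by
  apply Subtype.ext
  refine LinearEquiv.ext fun PQ => ?_
  obtain ⟨P, Q⟩ := PQ
  rw [Subgroup.coe_mul, Subgroup.coe_mul, LinearEquiv.mul_apply, LinearEquiv.mul_apply, coe_leviSp_apply,
    coe_beamSplitter, beamLin_apply, beamLin_apply, spBlock_sumSplit_symm]
  simp only [dblD_leviA, dblE_leviD, map_add, map_sub, coe_conjSp_apply, conjW_conjW]

omit [DecidableEq σ] in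
/-- The same identity as a conjugation: `T ⊕ cTc = beamSplitter · m(leviA T, leviD T) · beamSplitter⁻¹`.
[cite: GelbartPiatetskishapiroRallis1987, §1; Li1992, p. 181] -/
theorem spBlock_conjSp_eq (T : SpR σ) :
    spBlock (T, conjSp σ T) =
      beamSplitter σ * leviSp (dotPairing (σ ⊕ σ)) (leviA T) (leviD T) (leviA_had T) * (beamSplitter σ)⁻¹ := by
  rw [← spBlock_conjSp_mul_beamSplitter, mul_inv_cancel_right]

end Sp

end Literature.NumberTheory.Weil1964

end
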